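import Summits.CriticalPhenomena.CardyFormulaZ2.Theses.CardyIKTransport
import Literature.Probability.Percolation.QuadCrossingSquareModel
import Literature.Probability.Percolation.PlanarDuality
import Literature.Topology.PlaneTopology.PlusCrossing

/-!
# `RenewalGridHarmless` (stmt-CriticalPhenomena-4967), sandwich step 1: a crossing of the
# bulged template read in perturbed positions contains a crude crossing of `R`

Route `CardyIKTransport`, support item `RenewalGridHarmless`. Deterministic geometry for the
`liminf` half of the sandwich (no probability here).

Setting. `R` is a conformal rectangle with a square model `Φ : ℂ ≃ₜ ℂ` (`IsSquareModel`,
Schoenflies, `QuadCrossingSquareModel.lean`): `Φ` maps `(-1,1)²` onto `R.carrier` and side `k`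
onto `R.arc k`. The BULGED TEMPLATE `Q⁺_ε = perturbQuad Φ (-1+ε) (1-ε) (-1-ε) (1+ε)` is narrower
and taller than the model square: its arcs `0`/`2` (`Φ` of the bottom/top sides `im = ∓(1+ε)`)
lie OUTSIDE `closure R`, beyond `R.arc 0` / `R.arc 2`.

`exists_subchain_crossing` — let `w 0, …, w n` be a chain of lattice vertices with consecutive
open edges, read in two position maps: "hypothesis positions" `P'` (all `P' (w k)` in the closed
template, `P' (w 0)` / `P' (w n)` within `ρ/2` of its arcs `0` / `2`) and "true positions" `P`
(`dist (P (w k)) (P' (w k)) ≤ ρ/2`, consecutive true positions within `ρ' ≤ ρ`), where `ρ` is a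
room radius of the chart `Φ` at precision `ν` (`exists_chart_room`) with `2ν < ε`. Then a
sub-chain `w i, …, w j` has all its TRUE positions in `R.carrier`, starts within `ρ'` of
`R.arc 0` and ends within `ρ'` of `R.arc 2` — the chain, read in true positions, starts below
model height `-1` and ends above `+1`, so between its last passage below `-1` and its first
passage above `+1` it runs inside the open square, and the two boundary steps (length `≤ ρ'`)
straddle `Φ`(bottom side) `= R.arc 0` and `Φ`(top side) `= R.arc 2` (intermediate value theorem
along the step segment). In particular the open cluster event
`openConnIn {y | P y ∈ R.carrier} (w i) (w j)` holds. This is the slack-free inclusion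
"Hyp-crossing of `Q⁺_ε` ⊆ crude crossing of `R`", robust to an `o(1)` distortion `P' - P` of the
embedding; it is applied twice in the sequel (standard positions, and dual positions).

References: O. Schramm, S. Smirnov, Ann. Probab. 39 (2011) §5 (perturbed quads `Q^q`);
B. Bollobás, O. Riordan, *Percolation* (2006) Ch. 7 (boundary sandwich); the tree's
`QuadCrossingSquareModel.lean`, `PlusCrossing.lean` (`exists_chart_room`).
-/

noncomputable section

namespace Summit.CriticalPhenomena.CardyFormulaZ2.Theorems.CardyIKTransport.RenewalGridHarmless

open Filter Set Metric MeasureTheory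
open scoped Topology
open Literature.Probability.Percolation
open Literature.Probability.LatticeModels
open Literature.Probability.RandomPlanarGeometry
open Literature.Topology.PlaneTopology

/-! ### Index bookkeeping: last passage below `lo`, first passage above `hi` -/

/-- For a real sequence starting `≤ lo` and ending `≥ hi` (`lo < hi`) on `[0, n]`, there are indices
`k₀ < k₁ ≤ n` with `f k₀ ≤ lo`, `hi ≤ f k₁` and `lo < f k < hi` strictly between them (`k₁` the
first passage above `hi`, `k₀` the last passage below `lo` before it). [folklore] -/
theorem exists_passage_indices {f : ℕ → ℝ} {n : ℕ} {lo hi : ℝ} (hlh : lo < hi) (h0 : f 0 ≤ lo)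
    (hn : hi ≤ f n) :
    ∃ k₀ k₁ : ℕ, k₀ < k₁ ∧ k₁ ≤ n ∧ f k₀ ≤ lo ∧ hi ≤ f k₁ ∧
      ∀ k, k₀ < k → k < k₁ → lo < f k ∧ f k < hi := by
  classical
  have hex : ∃ k, hi ≤ f k := ⟨n, hn⟩
  set k₁ := Nat.find hex with hk₁
  have hk₁spec : hi ≤ f k₁ := Nat.find_spec hex
  have hk₁n : k₁ ≤ n := Nat.find_min' hex hn
  have hk₁min : ∀ k, k < k₁ → f k < hi := fun k hk => not_le.1 (Nat.find_min hex hk)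
  have hk₁pos : 0 < k₁ := by
    rcases Nat.eq_zero_or_pos k₁ with h | h
    · exfalso; rw [h] at hk₁spec; linarith
    · exact h
  set k₀ := Nat.findGreatest (fun k => f k ≤ lo) (k₁ - 1) with hk₀
  have hk₀spec : f k₀ ≤ lo := Nat.findGreatest_spec (P := fun k => f k ≤ lo) (Nat.zero_le _) h0
  have hk₀le : k₀ ≤ k₁ - 1 := Nat.findGreatest_le _
  refine ⟨k₀, k₁, by omega, hk₁n, hk₀spec, hk₁spec, fun k hk hk' => ⟨?_, hk₁min k hk'⟩⟩
  exact not_le.1 (Nat.findGreatest_is_greatest (P := fun k => f k ≤ lo) hk (by omega))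

/-! ### A step straddling a model level meets the level -/

/-- If the chart height `im ∘ Φ⁻¹` is `≤ c` at `p` and `≥ c` at `q`, some point of the segment
`[p, q]` has chart height exactly `c` (intermediate value theorem). [folklore] -/
theorem exists_mem_segment_im_symm_eq (Φ : ℂ ≃ₜ ℂ) {p q : ℂ} {c : ℝ}
    (hp : (Φ.symm p).im ≤ c) (hq : c ≤ (Φ.symm q).im) :
    ∃ z ∈ segment ℝ p q, (Φ.symm z).im = c := by
  set g : ℝ → ℝ := fun τ => (Φ.symm (AffineMap.lineMap p q τ)).im with hg
  have hgc : Continuous g :=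
    Complex.continuous_im.comp (Φ.symm.continuous.comp AffineMap.lineMap_continuous)
  have h0 : g 0 ≤ c := by simpa [hg] using hp
  have h1 : c ≤ g 1 := by simpa [hg] using hq
  obtain ⟨τ, hτ, hτc⟩ := intermediate_value_Icc zero_le_one hgc.continuousOn ⟨h0, h1⟩
  refine ⟨AffineMap.lineMap p q τ, ?_, hτc⟩
  rw [segment_eq_image_lineMap]
  exact mem_image_of_mem _ hτ

/-- Symmetric version: height `≥ c` at `p` and `≤ c` at `q`. [folklore] -/
theorem exists_mem_segment_im_symm_eq' (Φ : ℂ ≃ₜ ℂ) {p q : ℂ} {c : ℝ}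
    (hp : c ≤ (Φ.symm p).im) (hq : (Φ.symm q).im ≤ c) :
    ∃ z ∈ segment ℝ p q, (Φ.symm z).im = c := by
  obtain ⟨z, hz, hzc⟩ := exists_mem_segment_im_symm_eq Φ hq hp
  exact ⟨z, segment_symm ℝ p q ▸ hz, hzc⟩

/-- A point of the segment `[p, q]` is within `dist p q` of `q`. [folklore] -/
theorem dist_le_of_mem_segment {p q z : ℂ} (hz : z ∈ segment ℝ p q) : dist z q ≤ dist p q := by
  have := dist_add_dist_of_mem_segment hz
  linarith [dist_nonneg (x := p) (y := z)]

/-! ### The model square and the bulged template -/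

/-- The big model box `[-2, 2]²`, a compact set containing every template rectangle. [folklore] -/
theorem isCompact_modelBox : IsCompact (Icc (-2 : ℝ) 2 ×ℂ Icc (-2 : ℝ) 2) :=
  isCompact_Icc.reProdIm isCompact_Icc

/-- Membership in the big model box from coordinate bounds. [folklore] -/
theorem mem_modelBox {z : ℂ} (h1 : -2 ≤ z.re) (h2 : z.re ≤ 2) (h3 : -2 ≤ z.im) (h4 : z.im ≤ 2) :
    z ∈ Icc (-2 : ℝ) 2 ×ℂ Icc (-2 : ℝ) 2 :=
  Complex.mem_reProdIm.2 ⟨⟨h1, h2⟩, h3, h4⟩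

/-- In a square model, a point whose chart lies in the open square `(-1,1)²` is in `R`. [folklore] -/
theorem mem_carrier_of_symm_mem {R : ConformalRectangle} {Φ : ℂ ≃ₜ ℂ} (h : IsSquareModel R Φ)
    {p : ℂ} (hre : (Φ.symm p).re ∈ Ioo (-1 : ℝ) 1) (him : (Φ.symm p).im ∈ Ioo (-1 : ℝ) 1) :
    p ∈ R.carrier := by
  rw [← h.image_carrier, unitSquareQuad_carrier]
  exact ⟨Φ.symm p, Complex.mem_reProdIm.2 ⟨hre, him⟩, Φ.apply_symm_apply p⟩

/-- In a square model, a point whose chart lies on the bottom side of the square is on `R.arc 0`.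
[folklore] -/
theorem mem_arc_zero_of_symm {R : ConformalRectangle} {Φ : ℂ ≃ₜ ℂ} (h : IsSquareModel R Φ)
    {p : ℂ} (him : (Φ.symm p).im = -1) (hre : (Φ.symm p).re ∈ Icc (-1 : ℝ) 1) :
    p ∈ R.arc 0 := by
  rw [← h.image_arc 0]
  refine ⟨Φ.symm p, ?_, Φ.apply_symm_apply p⟩
  exact (mem_rectQuad_arc_zero (by norm_num) (by norm_num)).2 ⟨him, hre⟩

/-- In a square model, a point whose chart lies on the top side of the square is on `R.arc 2`.
[folklore] -/
theorem mem_arc_two_of_symm {R : ConformalRectangle} {Φ : ℂ ≃ₜ ℂ} (h : IsSquareModel R Φ)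
    {p : ℂ} (him : (Φ.symm p).im = 1) (hre : (Φ.symm p).re ∈ Icc (-1 : ℝ) 1) :
    p ∈ R.arc 2 := by
  rw [← h.image_arc 2]
  refine ⟨Φ.symm p, ?_, Φ.apply_symm_apply p⟩
  exact (mem_rectQuad_arc_two (by norm_num) (by norm_num)).2 ⟨him, hre⟩

/-! ### The sub-chain crossing -/

/-- Open chains give restricted open connections: if consecutive vertices `w k`, `w (k+1)`
(`i ≤ k < j`) are joined by open edges and all `w k` (`i ≤ k ≤ j`) lie in `S`, then
`{w i ↔ w j in S}`. [folklore] -/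
theorem openConnIn_of_chain {ω : BondConfig (Site 2)} {S : Set (Site 2)} {w : ℕ → Site 2}
    {i j : ℕ} (hij : i ≤ j) (hS : ∀ k, i ≤ k → k ≤ j → w k ∈ S)
    (hopen : ∀ k, i ≤ k → k < j → s(w k, w (k + 1)) ∈ ω ∧ w k ≠ w (k + 1)) :
    ω ∈ openConnIn S (w i) (w j) := by
  induction j, hij using Nat.le_induction with
  | base => exact openConnIn_refl (hS i le_rfl le_rfl)
  | succ j hij ih =>
    have h1 : ω ∈ openConnIn S (w i) (w j) :=
      ih (fun k hk hk' => hS k hk (hk'.trans (Nat.le_succ j)))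
        (fun k hk hk' => hopen k hk (hk'.trans (Nat.lt_succ_self j)))
    have h2 : ω ∈ openConnIn S (w j) (w (j + 1)) :=
      openConnIn_of_adj (hS j hij (Nat.le_succ j)) (hS (j + 1) (by omega) le_rfl)
        (hopen j hij (Nat.lt_succ_self j)).1 (hopen j hij (Nat.lt_succ_self j)).2
    exact PlanarDuality.openConnIn_trans h1 h2

/-- **The sub-chain crossing.** See the module docstring. Hypotheses: `h` square model of `R`;
`0 < ν`, `2ν < ε`, `ε ≤ 1/2`; `ρ` a room radius of `Φ` on the model box `[-2,2]²` at precision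
`ν`; `ρ' ≤ ρ`; a chain `w 0, …, w n` with open distinct consecutive edges, consecutive TRUE
positions `P` within `ρ'`, true and hypothesis positions within `ρ/2`, all hypothesis positions
`P'` in the closed template `Q⁺_ε` (read in the chart: `re ∈ [-1+ε, 1-ε]`, `im ∈ [-1-ε, 1+ε]`),
`P' (w 0)` within `ρ/2` of a point of chart height `-1-ε` and `P' (w n)` within `ρ/2` of a point
of chart height `1+ε`. Conclusion: a sub-chain `w i, …, w j` is an open connection inside
`{y | P y ∈ R}` from within `ρ'` of `R.arc 0` to within `ρ'` of `R.arc 2`. [folklore] -/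
theorem exists_subchain_crossing {R : ConformalRectangle} {Φ : ℂ ≃ₜ ℂ} (h : IsSquareModel R Φ)
    {ε ν ρ ρ' : ℝ} (hν : 0 < ν) (hνε : 2 * ν < ε) (hε : ε ≤ 1 / 2)
    (hroom : ∀ z ∈ Icc (-2 : ℝ) 2 ×ℂ Icc (-2 : ℝ) 2, ∀ p : ℂ, dist p (Φ z) ≤ ρ →
      dist (Φ.symm p) z ≤ ν)
    (hρ' : ρ' ≤ ρ) (hρ'0 : 0 ≤ ρ')
    {ω : BondConfig (Site 2)} {P P' : Site 2 → ℂ} {n : ℕ} {w : ℕ → Site 2}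
    (hopen : ∀ k, k < n → s(w k, w (k + 1)) ∈ ω ∧ w k ≠ w (k + 1))
    (hstep : ∀ k, k < n → dist (P (w k)) (P (w (k + 1))) ≤ ρ')
    (hclose : ∀ k, k ≤ n → dist (P (w k)) (P' (w k)) ≤ ρ / 2)
    (hin : ∀ k, k ≤ n → (Φ.symm (P' (w k))).re ∈ Icc (-1 + ε) (1 - ε) ∧
      (Φ.symm (P' (w k))).im ∈ Icc (-1 - ε) (1 + ε))
    (hstart : ∃ y : ℂ, (Φ.symm y).im = -1 - ε ∧ (Φ.symm y).re ∈ Icc (-1 + ε) (1 - ε) ∧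
      dist (P' (w 0)) y ≤ ρ / 2)
    (hend : ∃ y : ℂ, (Φ.symm y).im = 1 + ε ∧ (Φ.symm y).re ∈ Icc (-1 + ε) (1 - ε) ∧
      dist (P' (w n)) y ≤ ρ / 2) :
    ∃ i j : ℕ, i ≤ j ∧ j ≤ n ∧ ω ∈ openConnIn {y | P y ∈ R.carrier} (w i) (w j) ∧
      infDist (P (w i)) (R.arc 0) ≤ ρ' ∧ infDist (P (w j)) (R.arc 2) ≤ ρ' := by
  have hρ0 : 0 ≤ ρ := hρ'0.trans hρ'
  -- chart coordinates of the true positions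
  set m : ℕ → ℂ := fun k => Φ.symm (P (w k)) with hm
  -- the hypothesis positions pull back into the model box
  have hboxP' : ∀ k, k ≤ n → Φ.symm (P' (w k)) ∈ Icc (-2 : ℝ) 2 ×ℂ Icc (-2 : ℝ) 2 := by
    intro k hk
    obtain ⟨⟨h1, h2⟩, h3, h4⟩ := hin k hk
    exact mem_modelBox (by linarith) (by linarith) (by linarith) (by linarith)
  -- true chart coordinates are within `ν` of the hypothesis ones
  have hmclose : ∀ k, k ≤ n → dist (m k) (Φ.symm (P' (w k))) ≤ ν := by
    intro k hk
    refine hroom _ (hboxP' k hk) _ ?_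
    rw [Φ.apply_symm_apply]
    linarith [hclose k hk]
  have hmre : ∀ k, k ≤ n → (m k).re ∈ Icc (-1 + ε - ν) (1 - ε + ν) := by
    intro k hk
    have hd := hmclose k hk
    have h1 := (hin k hk).1
    have hre : |(m k).re - (Φ.symm (P' (w k))).re| ≤ ν :=
      (Complex.abs_re_le_norm (m k - Φ.symm (P' (w k)))).trans (by rwa [← dist_eq_norm])
    rw [abs_le] at hre
    exact ⟨by linarith [h1.1], by linarith [h1.2]⟩
  have hmim : ∀ k, k ≤ n → (m k).im ∈ Icc (-1 - ε - ν) (1 + ε + ν) := by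
    intro k hk
    have hd := hmclose k hk
    have h1 := (hin k hk).2
    have him : |(m k).im - (Φ.symm (P' (w k))).im| ≤ ν :=
      (Complex.abs_im_le_norm (m k - Φ.symm (P' (w k)))).trans (by rwa [← dist_eq_norm])
    rw [abs_le] at him
    exact ⟨by linarith [h1.1], by linarith [h1.2]⟩
  have hmbox : ∀ k, k ≤ n → m k ∈ Icc (-2 : ℝ) 2 ×ℂ Icc (-2 : ℝ) 2 := by
    intro k hk
    obtain ⟨h1, h2⟩ := hmre k hk
    obtain ⟨h3, h4⟩ := hmim k hk
    exact mem_modelBox (by linarith) (by linarith) (by linarith) (by linarith)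
  -- the chain starts below height `-1` and ends above `+1`
  have hm0 : (m 0).im ≤ -1 := by
    obtain ⟨y, hyim, hyre, hyd⟩ := hstart
    have hybox : Φ.symm y ∈ Icc (-2 : ℝ) 2 ×ℂ Icc (-2 : ℝ) 2 :=
      mem_modelBox (by linarith [hyre.1]) (by linarith [hyre.2]) (by linarith) (by linarith)
    have hd : dist (m 0) (Φ.symm y) ≤ ν := by
      refine hroom _ hybox _ ?_
      rw [Φ.apply_symm_apply]
      calc dist (P (w 0)) y ≤ dist (P (w 0)) (P' (w 0)) + dist (P' (w 0)) y := dist_triangle _ _ _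
        _ ≤ ρ / 2 + ρ / 2 := add_le_add (hclose 0 (Nat.zero_le n)) hyd
        _ = ρ := by ring
    have him : |(m 0).im - (Φ.symm y).im| ≤ ν :=
      (Complex.abs_im_le_norm (m 0 - Φ.symm y)).trans (by rwa [← dist_eq_norm])
    rw [abs_le, hyim] at him
    linarith [him.2]
  have hmn : 1 ≤ (m n).im := by
    obtain ⟨y, hyim, hyre, hyd⟩ := hend
    have hybox : Φ.symm y ∈ Icc (-2 : ℝ) 2 ×ℂ Icc (-2 : ℝ) 2 :=
      mem_modelBox (by linarith [hyre.1]) (by linarith [hyre.2]) (by linarith) (by linarith)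
    have hd : dist (m n) (Φ.symm y) ≤ ν := by
      refine hroom _ hybox _ ?_
      rw [Φ.apply_symm_apply]
      calc dist (P (w n)) y ≤ dist (P (w n)) (P' (w n)) + dist (P' (w n)) y := dist_triangle _ _ _
        _ ≤ ρ / 2 + ρ / 2 := add_le_add (hclose n le_rfl) hyd
        _ = ρ := by ring
    have him : |(m n).im - (Φ.symm y).im| ≤ ν :=
      (Complex.abs_im_le_norm (m n - Φ.symm y)).trans (by rwa [← dist_eq_norm])
    rw [abs_le, hyim] at him
    linarith [him.1]
  -- passage indices
  obtain ⟨k₀, k₁, hk₀₁, hk₁n, hk₀lo, hk₁hi, hmid⟩ :=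
    exists_passage_indices (f := fun k => (m k).im) (by norm_num : (-1 : ℝ) < 1) hm0 hmn
  -- consecutive chart points are within `ν`
  have hmstep : ∀ k, k < n → dist (m k) (m (k + 1)) ≤ ν := by
    intro k hk
    refine hroom _ (hmbox (k + 1) hk) _ ?_
    rw [hm]; simp only [Φ.apply_symm_apply]
    exact (hstep k hk).trans hρ'
  -- hence the two passages are not consecutive
  have hgap : k₀ + 1 < k₁ := by
    by_contra hc
    have hk : k₁ = k₀ + 1 := by omega
    have hd := hmstep k₀ (by omega)
    rw [← hk] at hd
    have him : |(m k₀).im - (m k₁).im| ≤ ν :=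
      (Complex.abs_im_le_norm (m k₀ - m k₁)).trans (by rwa [← dist_eq_norm])
    rw [abs_le] at him
    have hkk : (m k₁).im ≤ (m k₀).im + ν := by linarith [him.1]
    linarith [hνε, hε]
  -- the interior of the sub-chain lies in `R`
  have hinR : ∀ k, k₀ < k → k < k₁ → P (w k) ∈ R.carrier := by
    intro k hk hk'
    have hkn : k ≤ n := by omega
    refine mem_carrier_of_symm_mem h ⟨?_, ?_⟩ (hmid k hk hk')
    · linarith [(hmre k hkn).1]
    · linarith [(hmre k hkn).2]
  refine ⟨k₀ + 1, k₁ - 1, by omega, by omega, ?_, ?_, ?_⟩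
  · exact openConnIn_of_chain (by omega) (fun k hk hk' => hinR k (by omega) (by omega))
      (fun k hk hk' => hopen k (by omega))
  · -- the first step straddles `R.arc 0 = Φ(bottom side)`
    have hk₀n : k₀ < n := by omega
    have hlt : -1 < (m (k₀ + 1)).im := (hmid (k₀ + 1) (by omega) (by omega)).1
    obtain ⟨z, hz, hzim⟩ := exists_mem_segment_im_symm_eq Φ hk₀lo hlt.le
    have hzd : dist z (P (w (k₀ + 1))) ≤ ρ' := (dist_le_of_mem_segment hz).trans (hstep k₀ hk₀n)
    have hzch : dist (Φ.symm z) (m (k₀ + 1)) ≤ ν := by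
      refine hroom _ (hmbox (k₀ + 1) (by omega)) _ ?_
      rw [hm]; simp only [Φ.apply_symm_apply]
      exact hzd.trans hρ'
    have hzre : |(Φ.symm z).re - (m (k₀ + 1)).re| ≤ ν :=
      (Complex.abs_re_le_norm (Φ.symm z - m (k₀ + 1))).trans (by rwa [← dist_eq_norm])
    rw [abs_le] at hzre
    have hmr := hmre (k₀ + 1) (by omega)
    have hzA : z ∈ R.arc 0 :=
      mem_arc_zero_of_symm h hzim ⟨by linarith [hmr.1, hzre.1], by linarith [hmr.2, hzre.2]⟩
    calc infDist (P (w (k₀ + 1))) (R.arc 0) ≤ dist (P (w (k₀ + 1))) z := infDist_le_dist_of_mem hzA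
      _ ≤ ρ' := by rwa [dist_comm]
  · -- the last step straddles `R.arc 2 = Φ(top side)`
    have hk₁pos : 1 ≤ k₁ := by omega
    have hlt : (m (k₁ - 1)).im < 1 := (hmid (k₁ - 1) (by omega) (by omega)).2
    have he : k₁ - 1 + 1 = k₁ := by omega
    obtain ⟨z, hz, hzim⟩ := exists_mem_segment_im_symm_eq' Φ hk₁hi hlt.le
    have hst := hstep (k₁ - 1) (by omega)
    rw [he] at hst
    have hzd : dist z (P (w (k₁ - 1))) ≤ ρ' := (dist_le_of_mem_segment hz).trans (by rwa [dist_comm])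
    have hzch : dist (Φ.symm z) (m (k₁ - 1)) ≤ ν := by
      refine hroom _ (hmbox (k₁ - 1) (by omega)) _ ?_
      rw [hm]; simp only [Φ.apply_symm_apply]
      exact hzd.trans hρ'
    have hzre : |(Φ.symm z).re - (m (k₁ - 1)).re| ≤ ν :=
      (Complex.abs_re_le_norm (Φ.symm z - m (k₁ - 1))).trans (by rwa [← dist_eq_norm])
    rw [abs_le] at hzre
    have hmr := hmre (k₁ - 1) (by omega)
    have hzB : z ∈ R.arc 2 :=
      mem_arc_two_of_symm h hzim ⟨by linarith [hmr.1, hzre.1], by linarith [hmr.2, hzre.2]⟩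
    calc infDist (P (w (k₁ - 1))) (R.arc 2) ≤ dist (P (w (k₁ - 1))) z := infDist_le_dist_of_mem hzB
      _ ≤ ρ' := by rwa [dist_comm]

end Summit.CriticalPhenomena.CardyFormulaZ2.Theorems.CardyIKTransport.RenewalGridHarmless

end
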